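import Literature.Analysis.Convolution.OneSidedConvolution
import Literature.Combinatorics.Enumerative.ExpLogCoefficients
import HarnessLib

/-!
# One-sided convolution: powers and the expansion of powers of a combination of powers

Companion of `OneSidedConvolution.lean` (everything PROVED).

* `cpow f n = f^{⋆n}` (`n ≥ 1`; the value at `n = 0`, which would be a Dirac mass, is the junk
  value `0`), `cpow_succ`, `LocBdd.cpow`, **`cpow_add`** (`f^{⋆(m+n)} = f^{⋆m} ⋆ f^{⋆n}`);
* supports `cpow_eq_zero_of_lt` (`f = 0` below `η` ⟹ `f^{⋆n} = 0` below `nη`) and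
  `cpow_eq_zero_of_le` (`f = 0` on `[c,∞)` ⟹ `f^{⋆n} = 0` on `[nc, ∞)`); `cpow_nonneg`, `cpow_mono`,
  `setIntegral_cpow_le` (`∫_0^X f^{⋆n} ≤ (∫_0^X f)^n` for `f ≥ 0`), locality `cpow_congr_of_eqOn`;
* the derivation rule for powers `id_mul_cpow_succ`: `x f^{⋆(n+1)}(x) = (n+1)(f^{⋆n} ⋆ Df)(x)`;
* **`cpow_sum_cpow`**: on `[0, A]`, `(∑_{j=1}^{J} c_j ν^{⋆j})^{⋆r} = ∑_{n=1}^{N} E_r(n) ν^{⋆n}` with the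
  composition sums `E_r = compSum c r` of `ExpLogCoefficients.lean` (`ν = 0` below `η > 0`,
  `N ≤ J`, `A < (N+1)η`) — the bridge from the scalar `exp`/`log` coefficient identities to
  identities between convolution powers.
-/

noncomputable section

namespace Literature.Analysis.Convolution

open MeasureTheory Set Finset

/-! ### Convolution powers -/

/-- Convolution powers `f^{⋆n}` for `n ≥ 1`: `f^{⋆1} = f`, `f^{⋆(n+2)} = f ⋆ f^{⋆(n+1)}`. The value
at `n = 0` (which would be the Dirac mass, not a function) is the junk value `0`. [folklore] -/
def cpow (f : ℝ → ℝ) : ℕ → ℝ → ℝ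
  | 0 => fun _ => 0
  | 1 => f
  | n + 2 => oconv f (cpow f (n + 1))

section Powers

variable {f g : ℝ → ℝ}

/-- `f^{⋆0} = 0` (junk value). [folklore] -/
@[simp] theorem cpow_zero (f : ℝ → ℝ) : cpow f 0 = fun _ => 0 := rfl

/-- `f^{⋆1} = f`. [folklore] -/
@[simp] theorem cpow_one (f : ℝ → ℝ) : cpow f 1 = f := rfl

/-- `f^{⋆(n+2)} = f ⋆ f^{⋆(n+1)}`. [folklore] -/
theorem cpow_succ_succ (f : ℝ → ℝ) (n : ℕ) : cpow f (n + 2) = oconv f (cpow f (n + 1)) := rfl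

/-- `f^{⋆(n+1)} = f ⋆ f^{⋆n}` for `n ≥ 1`. [folklore] -/
theorem cpow_succ (f : ℝ → ℝ) {n : ℕ} (hn : 1 ≤ n) : cpow f (n + 1) = oconv f (cpow f n) := by
  obtain ⟨k, rfl⟩ : ∃ k, n = k + 1 := ⟨n - 1, by omega⟩
  rfl

/-- Convolution powers of a locally bounded measurable function are locally bounded measurable.
[folklore] -/
theorem LocBdd.cpow (hf : LocBdd f) : ∀ n, LocBdd (cpow f n)
  | 0 => LocBdd.zero
  | 1 => by rw [cpow_one]; exact hf
  | n + 2 => by rw [cpow_succ_succ]; exact hf.oconv (LocBdd.cpow hf (n + 1))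

/-- `f^{⋆n}(x) = 0` for `x ≤ 0`. [folklore] -/
theorem cpow_of_nonpos_of_two_le (f : ℝ → ℝ) {n : ℕ} (hn : 2 ≤ n) {x : ℝ} (hx : x ≤ 0) :
    cpow f n x = 0 := by
  obtain ⟨k, rfl⟩ : ∃ k, n = k + 2 := ⟨n - 2, by omega⟩
  rw [cpow_succ_succ, oconv_of_nonpos hx]

/-- **`f^{⋆(m+n)} = f^{⋆m} ⋆ f^{⋆n}`** (`m, n ≥ 1`). [folklore] -/
theorem cpow_add (hf : LocBdd f) {m n : ℕ} (hm : 1 ≤ m) (hn : 1 ≤ n) :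
    cpow f (m + n) = oconv (cpow f m) (cpow f n) := by
  induction m, hm using Nat.le_induction with
  | base => rw [cpow_one, add_comm, cpow_succ f hn]
  | succ m hm ih =>
    rw [show m + 1 + n = (m + n) + 1 by ring, cpow_succ f (by omega), ih, ← oconv_assoc hf
      (hf.cpow m) (hf.cpow n), ← cpow_succ f hm]

/-- Lower support: if `f = 0` on `(−∞, η)` then `f^{⋆n} = 0` on `(−∞, n η)` (`n ≥ 1`). [folklore] -/
theorem cpow_eq_zero_of_lt {η : ℝ} (hf : ∀ t, t < η → f t = 0) :
    ∀ {n : ℕ}, 1 ≤ n → ∀ {x : ℝ}, x < n * η → cpow f n x = 0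
  | 0, h, _, _ => (Nat.not_succ_le_zero 0 h).elim
  | 1, _, x, hx => by rw [cpow_one]; exact hf x (by simpa using hx)
  | n + 2, _, x, hx => by
    rw [cpow_succ_succ]
    refine oconv_eq_zero_of_lt hf (fun t ht => cpow_eq_zero_of_lt hf (n := n + 1) (by omega) ht) ?_
    push_cast at hx ⊢
    linarith

/-- Upper support: if `f = 0` on `[c, ∞)` then `f^{⋆n} = 0` on `[n c, ∞)` (`n ≥ 1`). [folklore] -/
theorem cpow_eq_zero_of_le {c : ℝ} (hf : ∀ t, c ≤ t → f t = 0) :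
    ∀ {n : ℕ}, 1 ≤ n → ∀ {x : ℝ}, n * c ≤ x → cpow f n x = 0
  | 0, h, _, _ => (Nat.not_succ_le_zero 0 h).elim
  | 1, _, x, hx => by rw [cpow_one]; exact hf x (by simpa using hx)
  | n + 2, _, x, hx => by
    rw [cpow_succ_succ]
    refine oconv_eq_zero_of_le hf (fun t ht => cpow_eq_zero_of_le hf (n := n + 1) (by omega) ht) ?_
    push_cast at hx ⊢
    linarith

/-- Non-negativity of powers of a non-negative function. [folklore] -/
theorem cpow_nonneg (hf0 : ∀ t, 0 ≤ f t) : ∀ (n : ℕ) (x : ℝ), 0 ≤ cpow f n x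
  | 0, _ => le_rfl
  | 1, x => by rw [cpow_one]; exact hf0 x
  | n + 2, x => by rw [cpow_succ_succ]; exact oconv_nonneg hf0 (cpow_nonneg hf0 (n + 1)) x

/-- Monotonicity of powers: `0 ≤ f ≤ g ⟹ f^{⋆n} ≤ g^{⋆n}`. [folklore] -/
theorem cpow_mono (hf : LocBdd f) (hg : LocBdd g) (hf0 : ∀ t, 0 ≤ f t) (hle : ∀ t, f t ≤ g t) :
    ∀ (n : ℕ) (x : ℝ), cpow f n x ≤ cpow g n x
  | 0, _ => le_rfl
  | 1, x => by rw [cpow_one, cpow_one]; exact hle x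
  | n + 2, x => by
    rw [cpow_succ_succ, cpow_succ_succ]
    have hg0 : ∀ t, 0 ≤ g t := fun t => (hf0 t).trans (hle t)
    calc oconv f (cpow f (n + 1)) x ≤ oconv g (cpow f (n + 1)) x :=
          oconv_mono_left hf hg (hf.cpow _) hle (cpow_nonneg hf0 _) x
      _ ≤ oconv g (cpow g (n + 1)) x :=
          oconv_mono_right hg (hf.cpow _) (hg.cpow _) (cpow_mono hf hg hf0 hle (n + 1)) hg0 x

/-- **`∫_0^X f^{⋆n} ≤ (∫_0^X f)^n`** for `f ≥ 0` (`n ≥ 1`). [folklore] -/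
theorem setIntegral_cpow_le (hf : LocBdd f) (hf0 : ∀ t, 0 ≤ f t) (X : ℝ) :
    ∀ {n : ℕ}, 1 ≤ n → ∫ x in Set.Ioc 0 X, cpow f n x ≤ (∫ t in Set.Ioc 0 X, f t) ^ n
  | 0, h => (Nat.not_succ_le_zero 0 h).elim
  | 1, _ => by rw [cpow_one, pow_one]
  | n + 2, _ => by
    rw [cpow_succ_succ, pow_succ']
    calc ∫ x in Set.Ioc 0 X, oconv f (cpow f (n + 1)) x
        ≤ (∫ t in Set.Ioc 0 X, f t) * ∫ u in Set.Ioc 0 X, cpow f (n + 1) u :=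
          setIntegral_oconv_le hf (hf.cpow _) hf0 (cpow_nonneg hf0 _) X
      _ ≤ (∫ t in Set.Ioc 0 X, f t) * (∫ t in Set.Ioc 0 X, f t) ^ (n + 1) :=
          mul_le_mul_of_nonneg_left (setIntegral_cpow_le hf hf0 X (n := n + 1) (by omega))
            (setIntegral_nonneg measurableSet_Ioc fun t _ => hf0 t)

/-- Locality of powers: `f = f'` on `[0, A] ⟹ f^{⋆n} = f'^{⋆n}` on `(−∞, A]`... restricted to
`[0, A]` for the induction; stated on `[0, A]`. [folklore] -/
theorem cpow_congr_of_eqOn {f' : ℝ → ℝ} {A : ℝ} (h : ∀ t ∈ Set.Icc 0 A, f t = f' t) :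
    ∀ (n : ℕ), ∀ x ∈ Set.Icc 0 A, cpow f n x = cpow f' n x
  | 0, _, _ => rfl
  | 1, x, hx => by rw [cpow_one, cpow_one]; exact h x hx
  | n + 2, x, hx => by
    rw [cpow_succ_succ, cpow_succ_succ]
    exact oconv_congr_of_eqOn h (cpow_congr_of_eqOn h (n + 1)) hx.2

/-- **The derivation rule for powers**: `x f^{⋆(n+1)}(x) = (n+1) (f^{⋆n} ⋆ Df)(x)` (`n ≥ 1`),
`Df(t) = t f(t)`. [folklore] -/
theorem id_mul_cpow_succ (hf : LocBdd f) {n : ℕ} (hn : 1 ≤ n) (x : ℝ) :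
    x * cpow f (n + 1) x = (n + 1 : ℝ) * oconv (cpow f n) (fun t => t * f t) x := by
  induction n, hn using Nat.le_induction generalizing x with
  | base =>
    rw [cpow_succ f le_rfl, cpow_one, id_mul_oconv hf hf, oconv_comm (fun t => t * f t) f]
    norm_num; ring
  | succ n hn ih =>
    rw [cpow_succ f (by omega : 1 ≤ n + 1), id_mul_oconv hf (hf.cpow _)]
    have hih : (fun t => t * cpow f (n + 1) t) = fun t => (n + 1 : ℝ) * oconv (cpow f n) (fun t => t * f t) t := by
      funext t; exact ih t
    rw [hih, oconv_const_mul_right, oconv_comm (fun t => t * f t) (cpow f (n + 1)),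
      ← oconv_assoc hf (hf.cpow n) hf.id_mul, ← cpow_succ f hn]
    push_cast
    ring

end Powers

/-! ### Expanding powers of a combination of powers -/

section Expansion

open Literature.Combinatorics.Enumerative

variable {ν : ℝ → ℝ}

/-- Shift identity used in the expansion: for `r ≥ 1` (so that `E_r(0) = 0`) and `G` vanishing
above `N`, `∑_{n=1}^{N} E_r(n) G(j + n) = ∑_{s=1}^{N} E_r(s − j) G(s)` (truncated subtraction).
[folklore] -/
theorem sum_compSum_shift (c : ℕ → ℝ) {r : ℕ} (hr : 1 ≤ r) {N : ℕ} (G : ℕ → ℝ)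
    (hG : ∀ s, N < s → G s = 0) (j : ℕ) :
    ∑ n ∈ Icc 1 N, compSum c r n * G (j + n) = ∑ s ∈ Icc 1 N, compSum c r (s - j) * G s := by
  have h0 : compSum c r 0 = 0 := compSum_eq_zero_of_lt c (by omega)
  -- both sides as sums over `range`
  have hL : ∑ n ∈ Icc 1 N, compSum c r n * G (j + n) =
      ∑ n ∈ range (N + 1), compSum c r n * G (j + n) := by
    rw [show Finset.Icc 1 N = Finset.Ico 1 (N + 1) by rfl, Finset.range_eq_Ico]
    refine (Finset.sum_subset (Finset.Ico_subset_Ico_left (by omega)) fun n hn hn' => ?_)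
    have : n = 0 := by
      simp only [Finset.mem_Ico] at hn hn'
      omega
    rw [this, h0, zero_mul]
  have hR : ∑ s ∈ Icc 1 N, compSum c r (s - j) * G s =
      ∑ s ∈ range (j + (N + 1)), compSum c r (s - j) * G s := by
    rw [show Finset.Icc 1 N = Finset.Ico 1 (N + 1) by rfl, Finset.range_eq_Ico]
    refine Finset.sum_subset (Finset.Ico_subset_Ico (by omega) (by omega)) fun s hs hs' => ?_
    simp only [Finset.mem_Ico] at hs hs'
    rcases Nat.eq_zero_or_pos s with h | h
    · subst h; rw [Nat.zero_sub, h0, zero_mul]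
    · rw [hG s (by omega), mul_zero]
  rw [hL, hR, Finset.sum_range_add (fun s => compSum c r (s - j) * G s) j (N + 1)]
  have hfirst : ∑ s ∈ range j, compSum c r (s - j) * G s = 0 := by
    refine Finset.sum_eq_zero fun s hs => ?_
    rw [Finset.mem_range] at hs
    rw [Nat.sub_eq_zero_of_le hs.le, h0, zero_mul]
  rw [hfirst, zero_add]
  refine Finset.sum_congr rfl fun n _ => ?_
  rw [Nat.add_sub_cancel_left]

/-- **Expansion of powers of a finite combination of convolution powers.** Let `ν` be locally
bounded, vanishing on `(−∞, η)` (`η > 0`), `c : ℕ → ℝ`, `N ≤ J` and `A < (N+1) η`. Then for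
`r ≥ 1` and `x ∈ [0, A]`:
`(∑_{j=1}^{J} c_j ν^{⋆j})^{⋆r}(x) = ∑_{n=1}^{N} E_r(n) ν^{⋆n}(x)`, `E_r(n) = compSum c r n` the
composition sums of the weights `c` (all powers `ν^{⋆n}`, `n > N`, vanish on `[0, A]`).
[folklore] -/
theorem cpow_sum_cpow (hν : LocBdd ν) {η A : ℝ} (hν0 : ∀ t, t < η → ν t = 0)
    (c : ℕ → ℝ) {J N : ℕ} (hNJ : N ≤ J) (hA : A < (N + 1) * η) {r : ℕ} (hr : 1 ≤ r) :
    ∀ x ∈ Set.Icc 0 A,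
      cpow (fun t => ∑ j ∈ Icc 1 J, c j * cpow ν j t) r x =
        ∑ n ∈ Icc 1 N, compSum c r n * cpow ν n x := by
  -- powers beyond `N` vanish on `[0, A]`
  have hvan : ∀ n, N < n → ∀ x ∈ Set.Icc 0 A, cpow ν n x = 0 := by
    intro n hn x hx
    refine cpow_eq_zero_of_lt hν0 (by omega) (lt_of_le_of_lt hx.2 (hA.trans_le ?_))
    have hη : 0 < η := by
      by_contra h
      have : (N + 1 : ℝ) * η ≤ 0 := mul_nonpos_of_nonneg_of_nonpos (by positivity) (not_lt.1 h)
      linarith [hx.1, hx.2]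
    exact mul_le_mul_of_nonneg_right (by exact_mod_cast hn) hη.le
  have hLB : ∀ n, LocBdd (fun t => c n * cpow ν n t) := fun n => (hν.cpow n).const_mul (c n)
  -- the truncated sum `S_N` agrees with `S` on `[0, A]`
  have hSN : ∀ t ∈ Set.Icc 0 A, ∑ j ∈ Icc 1 J, c j * cpow ν j t = ∑ j ∈ Icc 1 N, c j * cpow ν j t := by
    intro t ht
    refine (Finset.sum_subset (Finset.Icc_subset_Icc_right hNJ) fun j hj hjN => ?_).symm
    simp only [Finset.mem_Icc, not_and, not_le] at hj hjN
    rw [hvan j (hjN hj.1) t ht, mul_zero]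
  induction r, hr using Nat.le_induction with
  | base =>
    intro x hx
    rw [cpow_one, hSN x hx]
    exact Finset.sum_congr rfl fun n hn => by rw [compSum_one c (Finset.mem_Icc.1 hn).1]
  | succ r hr ih =>
    intro x hx
    rw [cpow_succ _ hr]
    -- locality: replace `S` by `S_N` and `S^{⋆r}` by the expansion
    rw [oconv_congr_of_eqOn hSN ih hx.2]
    -- bilinear expansion
    rw [oconv_sum_left _ (fun j _ => hLB j) (LocBdd.sum _ fun n _ => (hν.cpow n).const_mul _)]
    simp only [oconv_const_mul_left]
    have hinner : ∀ j ∈ Finset.Icc 1 N,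
        oconv (cpow ν j) (fun t => ∑ n ∈ Finset.Icc 1 N, compSum c r n * cpow ν n t) x =
          ∑ s ∈ Finset.Icc 1 N, compSum c r (s - j) * cpow ν s x := by
      intro j hj
      have hj1 : 1 ≤ j := (Finset.mem_Icc.1 hj).1
      rw [oconv_sum_right _ (hν.cpow j) (fun n _ => (hν.cpow n).const_mul _)]
      simp only [oconv_const_mul_right]
      have h2 : ∀ n ∈ Finset.Icc 1 N, compSum c r n * oconv (cpow ν j) (cpow ν n) x =
          compSum c r n * cpow ν (j + n) x := by
        intro n hn
        rw [← cpow_add hν hj1 (Finset.mem_Icc.1 hn).1]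
      rw [Finset.sum_congr rfl h2]
      exact sum_compSum_shift c hr (fun s => cpow ν s x) (fun s hs => hvan s hs x hx) j
    have hstep : ∑ j ∈ Finset.Icc 1 N, c j *
          oconv (cpow ν j) (fun t => ∑ n ∈ Finset.Icc 1 N, compSum c r n * cpow ν n t) x =
        ∑ j ∈ Finset.Icc 1 N, c j * ∑ s ∈ Finset.Icc 1 N, compSum c r (s - j) * cpow ν s x :=
      Finset.sum_congr rfl fun j hj => by rw [hinner j hj]
    rw [hstep]
    -- swap the sums and recognise `E_{r+1}`
    simp_rw [Finset.mul_sum]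
    rw [Finset.sum_comm]
    refine Finset.sum_congr rfl fun s hs => ?_
    have hs' := Finset.mem_Icc.1 hs
    rw [compSum_succ, Finset.sum_mul,
      ← Finset.sum_subset (Finset.Icc_subset_Icc_right hs'.2) (fun j hj hjs => ?_)]
    · exact Finset.sum_congr rfl fun j _ => by ring
    · simp only [Finset.mem_Icc, not_and, not_le] at hj hjs
      rw [Nat.sub_eq_zero_of_le (hjs hj.1).le, compSum_eq_zero_of_lt c (by omega)]
      ring

end Expansion

end Literature.Analysis.Convolution
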